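import Summits.QuantumFields.YangMills.Theorems.BalabanUVNodesN07Prop8StepFlatWitness
import Literature.MathematicalPhysics.QuantumFieldTheory.Balaban1983to89.Node00.CriticalOnFibreTopGuardedBPrint
import Literature.MathematicalPhysics.QuantumFieldTheory.Balaban1983to89.Node00.CriticalOnFibreB
import HarnessLib

/-!
# BalabanUVNodes ∕ K0⁷ — A6 FOR THE PRINT-DATUM EDITION: THE BINDER BLOCKS OF F0c's THREE `(bd, Dat[, Ex0])`-TOKENS `Prop8RegSepTopStepGB ∕ HalvingStepTopGB ∕ HalvingStepTopCoreGB`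
# ARE INHABITED AT THE FLAT DATUM — for EVERY bond datum `bd`, EVERY top-data predicate `Dat` that holds at the flat datum, EVERY guard met at the prefix letters; in particular at the
# (b)-instance `(genSetDatum F, dataSmall7PTopOf F N, printedPlaqs0Of F)` and at PRINT's `(lamDatum F, dataSmall7LamTopOf F N, lamPlaqs0Of F)` ((E1)∕(iii-b), director-ym №338∕№343; FLAG №16)

Cell `pub-ymgap`, width seat `pub-ymgap-dag-n07-w3` g15 (CLAIM A6ᴮ, bus 2026-08-30 ≈08:50Z).  `--kind proof --supports stmt-QuantumFields-20541 --as helper` (K0⁷; count-neutral; def-free).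
PURELY ADDITIVE — the print-datum re-keying of k0-s1-w3's `K0HalvingStepOfCoreGuardedChain.halvingStepTopCoreG_binders_inhabited_flat` (ref-G READ340 NOTE-1) and of dag-n07-e module 32's
`N07Prop8StepFlatWitness.prop8RegSepTopStep_binders_inhabited_flat ∕ halvingStepTop_binders_inhabited_flat`; those (b)-instances stay landed and true on their own text.
[15] = [Balaban1985Variational]; [6] = [Balaban1985RegularSpaces]; [II] = [Balaban1984PropagatorsII]; [III] = [Balaban1988Convergent]; [I] = [Balaban1987RG1].

WHY.  The (iii-b) edition re-keys every S6∕K0 token to a bond-level determining datum `bd : BondDatum F` and a top-data predicate `Dat : TopData F N` (F0c ✓p765717), read at print's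
[II] (2.3) datum `lamDatum F` and print's (7) data `dataSmall7LamTopOf F N` (P0 ✓p766390); dag-n07-e's chain of 2026-08-30 ends in the premise-free ∃-statement
`exists_prop8RegSepTopStepGB_lam` whose body is the ∀-token `Prop8RegSepTopStepGB F 2 suppDom (grid guard) (lamDatum F) (dataSmall7LamTopOf F 2) B₃ a₀ a₁`.  A ∀-token is only as good
as its binder block is inhabited (the HSEAM lesson, `…N07SeamNotInhabited.not_hseam` ✓p765776): this file records, in the kernel, that the binder blocks of all three GB tokens ARE
inhabited — together with their conclusions — at the flat datum `W ≡ 1`, `U ≡ 1` on n21-c's separated top index, for ANY `(bd, Dat)` with `Dat` true at the flat datum and any guard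
holding at the chosen prefix letters `(ν, M, g, K, k)`.  The two rows that change under the re-keying are harmless at the flat datum: `AgreeOnB (bd K k s.Ω) (Ū 1) 1` because
`Ū^{(j)}(1) = 1` (`avgFamily_avOfRecord_one`), and `IsCritOnFibreB F N K (bd K k s.Ω) 1 1` for EVERY bond datum by Fermat at the zero of the Wilson action (F0b
`isCritOnFibreB_of_wilsonAction4_eq_zero`).  Print's data predicate holds at the flat datum for every splice set (§1 `mixedFieldB_avOfRecord_one`, `dataSmall7LamTop_one`).

WHAT IS PROVED (sorry-free; no definition; axioms standard).
§1 flat rows over a bond datum: `mixedFieldB_avOfRecord_one`, `dataSmall7LamTop_one`, `dataSmall7LamTopOf_one`, `dataSmall7PTopOf_one`, `agreeOnB_avgFamily_avOfRecord_one`, `isCritOnFibreB_one`.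
§2 ★★ `prop8RegSepTopStepGB_binders_inhabited_flat`, ★★ `halvingStepTopGB_binders_inhabited_flat`, ★★ `halvingStepTopCoreGB_binders_inhabited_flat` — generic in `(Sup, Adm, bd, Dat[, Ex0])`,
   hypotheses `hDat` (the predicate holds at the flat datum for positive thresholds) and `hAdm : ∀ s, Adm ν M g K k s`.
§3 the instances of record: `…_binders_inhabited_flat_b` at `(genSetDatum F, dataSmall7PTopOf F N[, printedPlaqs0Of F])` and ★★ `…_binders_inhabited_flat_lam` at
   `(lamDatum F, dataSmall7LamTopOf F N[, lamPlaqs0Of F])`, for all three tokens.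
HONEST FRAMING: A6 bookkeeping — the ∀-tokens themselves ([15] Sect. F ∕ Prop. 8 at the chosen datum) are NOT asserted; a flat witness says «the binder block is not empty», nothing
about Bałaban's analysis and nothing about non-flat data; no (b)-instance claimed false; K0⁷ stub 1 NOT closed; N05 ∕ N07 NOT discharged; counts unmoved (typed 28∕28 · discharged
8∕28); R4 = the conditional finite-𝕋⁴ rung `BalabanLadder.UV` ONLY; the YM mass gap (Clay) is NOT proved by any of this; nothing continuum ∕ ℝ⁴ ∕ OS.  No `sorry` ∕ `def` ∕ `instance` ∕ `notation`.

References: [15] (2)–(8) pp. 278–279, Sect. F p. 304, Prop. 8 p. 304; [6] (1.3)–(1.9) p. 77; [II] (2.3) p. 224; [III] (2.1) p. 254, (2.10)–(2.12) p. 256, (2.18) p. 257; [I] (0.1)–(0.4) pp. 251–253.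
-/

set_option autoImplicit false

noncomputable section

open scoped Matrix.Norms.L2Operator

namespace Summit.QuantumFields.YangMills.BalabanUVNodes.K0FlatWitnessB

open Literature.MathematicalPhysics.QuantumFieldTheory.Balaban1983to89
open Literature.MathematicalPhysics.QuantumFieldTheory.Balaban1983to89.T4Continuum (T4Family)
open Literature.MathematicalPhysics.QuantumFieldTheory.Balaban1983to89.B15DeterminingSets
open Literature.MathematicalPhysics.QuantumFieldTheory.Balaban1983to89.B15DeterminingSetsB
open Literature.MathematicalPhysics.QuantumFieldTheory.Balaban1983to89.Node00
open Summit.QuantumFields.YangMills.Theorems.K0TopIndexWrapGeometry (exists_seq_top)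
open Summit.QuantumFields.YangMills.BalabanUVNodes.N07AvoidanceAtFlatData (wilsonAction4_one)
open Summit.QuantumFields.YangMills.BalabanUVNodes.N07Prop8StepFlatWitness (avgFamily_avOfRecord_one plaqSmallOn_one coDivSmallOn_one dataSmall7PTop_one)

/-! ## §1  Flat rows over a bond datum -/

section Flat

variable (F : T4Family) (N : ℕ) [NeZero N]

/-- Print's (7) field SPLICED ALONG ANY BOND SET of two flat levels is flat (on the splice set it reads `1`, off it `Ū(1) = 1`). [cite: Balaban1985Variational, (7) p.278 (bookkeeping); Balaban1987RG1, (0.4) p.253] -/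
theorem mixedFieldB_avOfRecord_one (K : ℕ) {m : ℕ} (S : Set (PBond (F.P K) (m + 1))) :
    Sect2.mixedFieldB (avOfRecord F N K) S (1 : GaugeField (F.P K) (m + 1) (SU N)) (1 : GaugeField (F.P K) m (SU N)) = 1 := by
  funext b
  by_cases hb : b ∈ S
  · rw [Sect2.mixedFieldB_of_mem (avOfRecord F N K) _ _ hb]
  · rw [Sect2.mixedFieldB_of_not_mem (avOfRecord F N K) _ _ hb]
    show (BlockAveraging.blockAvg ExpMeanLog.expMeanLogSU).avg (1 : GaugeField (F.P K) m (SU N)) b = 1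
    rw [BlockAveraging.blockAvg_avg, T3DescentFibreTower.avgFun_one _ T3DescentFibreTower.expMeanLogSU_E_one]
    rfl

/-- **PRINT's DATA CONDITION (7) UNDER (α) HOLDS AT THE FLAT DATUM** (top-domain form, §7′'s `Sect2.DataSmall7LamTop`), at every positive threshold profile: level 0 on the `Λ₀`-plaquettes of
the top domain, level `m+1` for the field spliced along `Λ_{m+1}`'s bonds — both flat. [cite: Balaban1985Variational, (3),(7) p.278 L20–33; Balaban1984PropagatorsII, (2.3) p.224 (bookkeeping)] -/
theorem dataSmall7LamTop_one (K : ℕ) (Ω : ℕ → Set (Site (F.P K) 0)) (Ω₀ : Set (Site (F.P K) 0)) (k : ℕ) {δ : ℕ → ℝ} (hδ : ∀ n, n ≤ k → 0 < δ n) :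
    Sect2.DataSmall7LamTop (avOfRecord F N K) Ω Ω₀ k δ (fun _ _ => (1 : SU N)) := by
  refine ⟨plaqSmallOn_one _ (hδ 0 (Nat.zero_le _)), fun m hm => ?_⟩
  have h1 : Sect2.mixedFieldB (avOfRecord F N K) (lamBondsSeq Ω k (m + 1)) ((fun _ _ => (1 : SU N)) (m + 1)) ((fun _ _ => (1 : SU N)) m) =
      (1 : GaugeField (F.P K) (m + 1) (SU N)) := mixedFieldB_avOfRecord_one F N K _
  rw [h1]
  exact plaqSmallOn_one _ (hδ (m + 1) hm)

/-- P0's print data plug `dataSmall7LamTopOf F N` holds at the flat datum (positive thresholds). [cite: Balaban1985Variational, (7) p.278 (bookkeeping)] -/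
theorem dataSmall7LamTopOf_one (K : ℕ) (Ω : ℕ → Set (Site (F.P K) 0)) (Ω₀ : Set (Site (F.P K) 0)) (k : ℕ) (δ : ℕ → ℝ) (hδ : ∀ n, n ≤ k → 0 < δ n) :
    dataSmall7LamTopOf F N K Ω Ω₀ k δ (fun _ _ => (1 : SU N)) :=
  (dataSmall7LamTopOf_apply K Ω Ω₀ k δ _).2 (dataSmall7LamTop_one F N K Ω Ω₀ k hδ)

/-- F0c's (b) data plug `dataSmall7PTopOf F N` holds at the flat datum (positive thresholds; module 32's `dataSmall7PTop_one`). [cite: Balaban1985Variational, (7) p.278 (bookkeeping)] -/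
theorem dataSmall7PTopOf_one (K : ℕ) (Ω : ℕ → Set (Site (F.P K) 0)) (Ω₀ : Set (Site (F.P K) 0)) (k : ℕ) (δ : ℕ → ℝ) (hδ : ∀ n, n ≤ k → 0 < δ n) :
    dataSmall7PTopOf F N K Ω Ω₀ k δ (fun _ _ => (1 : SU N)) :=
  (dataSmall7PTopOf_apply K Ω Ω₀ k δ _).2 (dataSmall7PTop_one K Ω Ω₀ k hδ)

/-- The flat configuration lies on the fibre of the flat datum over EVERY bond-level determining set (`Ū^{(j)}(1) = 1`). [cite: Balaban1988Convergent, (2.10)–(2.12) p.256 (bookkeeping)] -/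
theorem agreeOnB_avgFamily_avOfRecord_one (K : ℕ) (𝔅 : BDetSet (F.P K)) :
    AgreeOnB 𝔅 (avgFamily (avOfRecord F N K) (1 : GaugeField (F.P K) 0 (SU N))) (fun _ _ => (1 : SU N)) := by
  intro j b _
  rw [avgFamily_avOfRecord_one]

/-- The flat configuration is critical on EVERY fibre over EVERY bond datum (zero action; F0b's Fermat lemma). [cite: Balaban1985Variational, (5) p.278; Balaban1987RG1, (0.2) p.252 (bookkeeping)] -/
theorem isCritOnFibreB_one (K : ℕ) (𝔅 : BDetSet (F.P K)) (W : MSField (F.P K) (SU N)) : IsCritOnFibreB F N K 𝔅 W (1 : GaugeField (F.P K) 0 (SU N)) :=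
  isCritOnFibreB_of_wilsonAction4_eq_zero wilsonAction4_one

/-- `0 < η_n` on the lattices of record. [cite: Balaban1987RG1, (1.1) p.260 (bookkeeping)] -/
private theorem eta_pos_b (P : Params) (n : ℕ) : 0 < P.eta n := by
  unfold Params.eta
  exact pow_pos (inv_pos.mpr (Nat.cast_pos.mpr P.L_pos)) n

end Flat

/-! ## §2  The binder blocks of the three GB tokens are inhabited at the flat datum, for any `(bd, Dat[, Ex0])` with `Dat` true there and any guard met at the prefix letters -/

section Generic

variable (F : T4Family) (N : ℕ) [NeZero N]

/-- ★★ **A6 FOR `Prop8RegSepTopStepGB`**: for every top domain `Sup`, guard `Adm`, bond datum `bd`, top-data predicate `Dat` TRUE AT THE FLAT DATUM for positive thresholds (`hDat`), constants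
`B₃ > 0`, `a₀, a₁ > 0`, and prefix letters `ν` (`0 < M₁`), `M ≥ 1`, `g`, `K`, `k ≥ 1` at which the guard holds for every index (`hAdm`): there are an index `s`, a radius `ε₀`, thresholds
`δ`, a datum `W` and a configuration `U` meeting EVERY binder of `Prop8RegSepTopStepGB F N Sup Adm bd Dat B₃ a₀ a₁` AND its conclusion (8) (both halves).  Witness `ε₀ := a₀`,
`δ_n := min a₁ (a₀∕B₃)`, `W ≡ 1`, `U ≡ 1` on n21-c's separated top index.  The ∀-token is NOT asserted.
[cite: Balaban1985Variational, Prop. 8 p.304, (2)–(8) pp.278–279; Balaban1985RegularSpaces, (1.7)–(1.9) p.77; Balaban1984PropagatorsII, (2.3) p.224; Balaban1988Convergent, (2.18) p.257] -/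
theorem prop8RegSepTopStepGB_binders_inhabited_flat
    (Sup : (ν : Stage7Numerics) → (K : ℕ) → (ℕ → Set (Site (F.P K) 0)) → Set (Site (F.P K) 0)) {Adm : StepGuard F} (bd : BondDatum F) {Dat : TopData F N}
    (hDat : ∀ (K : ℕ) (Ω : ℕ → Set (Site (F.P K) 0)) (Ω₀ : Set (Site (F.P K) 0)) (k : ℕ) (δ : ℕ → ℝ), (∀ n, n ≤ k → 0 < δ n) → Dat K Ω Ω₀ k δ (fun _ _ => (1 : SU N)))
    {B₃ a₀ a₁ : ℝ} (hB₃ : 0 < B₃) (ha₀ : 0 < a₀) (ha₁ : 0 < a₁) (ν : Stage7Numerics) (hM₁ : 0 < ν.M₁) {M : ℕ} (hM : 1 ≤ M) (g : ℕ → ℝ) (K k : ℕ) (hk : 1 ≤ k)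
    (hAdm : ∀ s : SeqOfRecord F ν M g K k, Adm ν M g K k s) :
    ∃ (s : SeqOfRecord F ν M g K k) (ε₀ : ℝ) (δ : ℕ → ℝ) (W : MSField (F.P K) (SU N)) (U : GaugeField (F.P K) 0 (SU N)),
      Sect2.SeqSeparated ν.M₁ s ∧ 0 < ν.M₁ ∧ Adm ν M g K k s ∧ 1 ≤ k ∧
      (∀ n, n ≤ k → 0 < δ n ∧ δ n ≤ a₁ ∧ B₃ * δ n ≤ ε₀) ∧ (∀ n, n < k → δ n ≤ 2 * δ (n + 1)) ∧ (∀ n, n < k → δ (n + 1) ≤ 2 * δ n) ∧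
      ε₀ ≤ a₀ ∧ Dat K s.Ω (Sup ν K s.Ω) k δ W ∧
      (∀ n, n ≤ k → PlaqSmallOn (Sect2.omegaPlaqsTop s.Ω (Sup ν K s.Ω) n) (ε₀ * (F.P K).eta n ^ 2) U) ∧
      Sect2.CoDivClassOnTop s.Ω (Sup ν K s.Ω) k ε₀ U ∧ AgreeOnB (bd K k s.Ω) (avgFamily (avOfRecord F N K) U) W ∧
      IsCritOnFibreB F N K (bd K k s.Ω) W U ∧
      ((∀ n, n ≤ k → PlaqSmallOn (Sect2.omegaPlaqsTop s.Ω (Sup ν K s.Ω) n) (B₃ * δ n * (F.P K).eta n ^ 2) U) ∧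
        ∀ n, n ≤ k → Sect2.CoDivSmallOn (Sect2.omegaBondsTop s.Ω (Sup ν K s.Ω) n) (B₃ * δ n * (F.P K).eta n ^ 3) U) := by
  obtain ⟨s, -, hsep⟩ := exists_seq_top F ν hM g K k
  have hδ0 : 0 < min a₁ (a₀ / B₃) := lt_min ha₁ (div_pos ha₀ hB₃)
  have hBδ : B₃ * min a₁ (a₀ / B₃) ≤ a₀ :=
    (mul_le_mul_of_nonneg_left (min_le_right _ _) hB₃.le).trans (by rw [mul_div_cancel₀ _ hB₃.ne'])
  have hη : ∀ n, 0 < (F.P K).eta n := eta_pos_b (F.P K)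
  exact ⟨s, a₀, fun _ => min a₁ (a₀ / B₃), fun _ _ => 1, 1, hsep, hM₁, hAdm s, hk, fun n _ => ⟨hδ0, min_le_left _ _, hBδ⟩,
    fun n _ => by linarith, fun n _ => by linarith, le_rfl, hDat K s.Ω (Sup ν K s.Ω) k _ fun n _ => hδ0,
    fun n _ => plaqSmallOn_one _ (mul_pos ha₀ (pow_pos (hη n) 2)), fun n _ => coDivSmallOn_one _ (mul_pos ha₀ (pow_pos (hη n) 3)),
    agreeOnB_avgFamily_avOfRecord_one F N K _, isCritOnFibreB_one F N K _ _,
    fun n _ => plaqSmallOn_one _ (mul_pos (mul_pos hB₃ hδ0) (pow_pos (hη n) 2)), fun n _ => coDivSmallOn_one _ (mul_pos (mul_pos hB₃ hδ0) (pow_pos (hη n) 3))⟩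

/-- ★★ **A6 FOR `HalvingStepTopGB`** (class radii `ε ≡ a₀`): the binder block of `HalvingStepTopGB F N Sup Adm bd Dat B₃ a₀ a₁` — guard included — AND its conclusion (the class at the halved
radii `max{B₃δ_n, ½ε_n}`) are jointly inhabited at the flat datum on the separated top index, for any `(bd, Dat)` with `Dat` true at the flat datum.  The ∀-token is NOT asserted.
[cite: Balaban1985Variational, Sect. F p.304 (before Prop. 8), (2)–(7) p.278; Balaban1985RegularSpaces, (1.7)–(1.9) p.77; Balaban1984PropagatorsII, (2.3) p.224; Balaban1988Convergent, (2.18) p.257] -/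
theorem halvingStepTopGB_binders_inhabited_flat
    (Sup : (ν : Stage7Numerics) → (K : ℕ) → (ℕ → Set (Site (F.P K) 0)) → Set (Site (F.P K) 0)) {Adm : StepGuard F} (bd : BondDatum F) {Dat : TopData F N}
    (hDat : ∀ (K : ℕ) (Ω : ℕ → Set (Site (F.P K) 0)) (Ω₀ : Set (Site (F.P K) 0)) (k : ℕ) (δ : ℕ → ℝ), (∀ n, n ≤ k → 0 < δ n) → Dat K Ω Ω₀ k δ (fun _ _ => (1 : SU N)))
    {B₃ a₀ a₁ : ℝ} (hB₃ : 0 < B₃) (ha₀ : 0 < a₀) (ha₁ : 0 < a₁) (ν : Stage7Numerics) (hM₁ : 0 < ν.M₁) {M : ℕ} (hM : 1 ≤ M) (g : ℕ → ℝ) (K k : ℕ) (hk : 1 ≤ k)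
    (hAdm : ∀ s : SeqOfRecord F ν M g K k, Adm ν M g K k s) :
    ∃ (s : SeqOfRecord F ν M g K k) (ε δ : ℕ → ℝ) (W : MSField (F.P K) (SU N)) (U : GaugeField (F.P K) 0 (SU N)),
      Sect2.SeqSeparated ν.M₁ s ∧ 0 < ν.M₁ ∧ Adm ν M g K k s ∧ 1 ≤ k ∧
      (∀ n, n ≤ k → 0 < δ n ∧ δ n ≤ a₁) ∧ (∀ n, n < k → δ n ≤ 2 * δ (n + 1)) ∧ (∀ n, n < k → δ (n + 1) ≤ 2 * δ n) ∧
      (∀ n, n ≤ k → B₃ * δ n ≤ ε n ∧ ε n ≤ a₀) ∧ (∀ n, n < k → ε n ≤ 2 * ε (n + 1)) ∧ (∀ n, n < k → ε (n + 1) ≤ 2 * ε n) ∧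
      Dat K s.Ω (Sup ν K s.Ω) k δ W ∧
      (∀ n, n ≤ k → PlaqSmallOn (Sect2.omegaPlaqsTop s.Ω (Sup ν K s.Ω) n) (ε n * (F.P K).eta n ^ 2) U) ∧
      (∀ n, n ≤ k → Sect2.CoDivSmallOn (Sect2.omegaBondsTop s.Ω (Sup ν K s.Ω) n) (ε n * (F.P K).eta n ^ 3) U) ∧
      AgreeOnB (bd K k s.Ω) (avgFamily (avOfRecord F N K) U) W ∧ IsCritOnFibreB F N K (bd K k s.Ω) W U ∧
      ((∀ n, n ≤ k → PlaqSmallOn (Sect2.omegaPlaqsTop s.Ω (Sup ν K s.Ω) n) (max (B₃ * δ n) (ε n / 2) * (F.P K).eta n ^ 2) U) ∧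
        ∀ n, n ≤ k → Sect2.CoDivSmallOn (Sect2.omegaBondsTop s.Ω (Sup ν K s.Ω) n) (max (B₃ * δ n) (ε n / 2) * (F.P K).eta n ^ 3) U) := by
  obtain ⟨s, -, hsep⟩ := exists_seq_top F ν hM g K k
  have hδ0 : 0 < min a₁ (a₀ / B₃) := lt_min ha₁ (div_pos ha₀ hB₃)
  have hBδ : B₃ * min a₁ (a₀ / B₃) ≤ a₀ :=
    (mul_le_mul_of_nonneg_left (min_le_right _ _) hB₃.le).trans (by rw [mul_div_cancel₀ _ hB₃.ne'])
  have hη : ∀ n, 0 < (F.P K).eta n := eta_pos_b (F.P K)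
  have hmax : ∀ n : ℕ, 0 < max (B₃ * min a₁ (a₀ / B₃)) (a₀ / 2) := fun _ => lt_max_of_lt_right (half_pos ha₀)
  exact ⟨s, fun _ => a₀, fun _ => min a₁ (a₀ / B₃), fun _ _ => 1, 1, hsep, hM₁, hAdm s, hk, fun n _ => ⟨hδ0, min_le_left _ _⟩,
    fun n _ => by linarith, fun n _ => by linarith, fun n _ => ⟨hBδ, le_rfl⟩, fun n _ => by linarith, fun n _ => by linarith,
    hDat K s.Ω (Sup ν K s.Ω) k _ fun n _ => hδ0,
    fun n _ => plaqSmallOn_one _ (mul_pos ha₀ (pow_pos (hη n) 2)), fun n _ => coDivSmallOn_one _ (mul_pos ha₀ (pow_pos (hη n) 3)),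
    agreeOnB_avgFamily_avOfRecord_one F N K _, isCritOnFibreB_one F N K _ _,
    fun n _ => plaqSmallOn_one _ (mul_pos (hmax n) (pow_pos (hη n) 2)), fun n _ => coDivSmallOn_one _ (mul_pos (hmax n) (pow_pos (hη n) 3))⟩

/-- ★★ **A6 FOR THE CORE FORM `HalvingStepTopCoreGB`** (any level-0 exclusion range `Ex0`): its binder block — guard included — AND its (restricted) conclusion are jointly inhabited at the
flat datum, for any `(bd, Dat, Ex0)` with `Dat` true at the flat datum.  The ∀-token is NOT asserted.
[cite: Balaban1985Variational, Sect. F p.304, (2)–(7) p.278; Balaban1985RegularSpaces, (1.2) p.76, (1.7)–(1.9) p.77; Balaban1984PropagatorsII, (2.3) p.224; Balaban1988Convergent, (2.18) p.257] -/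
theorem halvingStepTopCoreGB_binders_inhabited_flat
    (Sup : (ν : Stage7Numerics) → (K : ℕ) → (ℕ → Set (Site (F.P K) 0)) → Set (Site (F.P K) 0)) {Adm : StepGuard F} (bd : BondDatum F) {Dat : TopData F N} (Ex0 : PlaqRange0 F)
    (hDat : ∀ (K : ℕ) (Ω : ℕ → Set (Site (F.P K) 0)) (Ω₀ : Set (Site (F.P K) 0)) (k : ℕ) (δ : ℕ → ℝ), (∀ n, n ≤ k → 0 < δ n) → Dat K Ω Ω₀ k δ (fun _ _ => (1 : SU N)))
    {B₃ a₀ a₁ : ℝ} (hB₃ : 0 < B₃) (ha₀ : 0 < a₀) (ha₁ : 0 < a₁) (ν : Stage7Numerics) (hM₁ : 0 < ν.M₁) {M : ℕ} (hM : 1 ≤ M) (g : ℕ → ℝ) (K k : ℕ) (hk : 1 ≤ k)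
    (hAdm : ∀ s : SeqOfRecord F ν M g K k, Adm ν M g K k s) :
    ∃ (s : SeqOfRecord F ν M g K k) (ε δ : ℕ → ℝ) (W : MSField (F.P K) (SU N)) (U : GaugeField (F.P K) 0 (SU N)),
      Sect2.SeqSeparated ν.M₁ s ∧ 0 < ν.M₁ ∧ Adm ν M g K k s ∧ 1 ≤ k ∧
      (∀ n, n ≤ k → 0 < δ n ∧ δ n ≤ a₁) ∧ (∀ n, n < k → δ n ≤ 2 * δ (n + 1)) ∧ (∀ n, n < k → δ (n + 1) ≤ 2 * δ n) ∧
      (∀ n, n ≤ k → B₃ * δ n ≤ ε n ∧ ε n ≤ a₀) ∧ (∀ n, n < k → ε n ≤ 2 * ε (n + 1)) ∧ (∀ n, n < k → ε (n + 1) ≤ 2 * ε n) ∧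
      Dat K s.Ω (Sup ν K s.Ω) k δ W ∧
      (∀ n, n ≤ k → PlaqSmallOn (Sect2.omegaPlaqsTop s.Ω (Sup ν K s.Ω) n) (ε n * (F.P K).eta n ^ 2) U) ∧
      (∀ n, n ≤ k → Sect2.CoDivSmallOn (Sect2.omegaBondsTop s.Ω (Sup ν K s.Ω) n) (ε n * (F.P K).eta n ^ 3) U) ∧
      AgreeOnB (bd K k s.Ω) (avgFamily (avOfRecord F N K) U) W ∧ IsCritOnFibreB F N K (bd K k s.Ω) W U ∧
      ((∀ n, n ≤ k → ∀ p ∈ Sect2.omegaPlaqsTop s.Ω (Sup ν K s.Ω) n, p ∉ Ex0 K k s.Ω →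
          dist1 (GaugeField.plaqHol U p) < max (B₃ * δ n) (ε n / 2) * (F.P K).eta n ^ 2) ∧
        ∀ n, n ≤ k → ∀ b ∈ Sect2.omegaBondsTop s.Ω (Sup ν K s.Ω) n, b ∉ Sect2.bondsDeep (s.Ω 1)ᶜ →
          ‖Sect2.coDivSum U b.src b.dir‖ < max (B₃ * δ n) (ε n / 2) * (F.P K).eta n ^ 3) := by
  obtain ⟨s, ε, δ, W, U, hsep, hM₁', hadm, hk', hδ, hc, hc', hε, hec, hec', h7, h17, h19, hfib, hcrit, hP, hD⟩ :=
    halvingStepTopGB_binders_inhabited_flat F N Sup bd hDat hB₃ ha₀ ha₁ ν hM₁ hM g K k hk hAdm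
  exact ⟨s, ε, δ, W, U, hsep, hM₁', hadm, hk', hδ, hc, hc', hε, hec, hec', h7, h17, h19, hfib, hcrit,
    fun n hn p hp _ => hP n hn p hp, fun n hn b hb _ => hD n hn b hb⟩

end Generic

/-! ## §3  The two instances of record: reading (b) `(genSetDatum, dataSmall7PTopOf, printedPlaqs0Of)` and PRINT `(lamDatum, dataSmall7LamTopOf, lamPlaqs0Of)` -/

section Instances

variable (F : T4Family) (N : ℕ) [NeZero N]

/-- ★★ **A6 AT PRINT's [II] (2.3) DATUM AND PRINT's (7) DATA, FOR [15] PROP. 8's TOP STEP**: the binder block of `Prop8RegSepTopStepGB F N Sup Adm (lamDatum F) (dataSmall7LamTopOf F N) B₃ a₀ a₁`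
(the body of dag-n07-e's `exists_prop8RegSepTopStepGB_lam` at `Sup := suppDom`, its grid guard) AND its conclusion are jointly inhabited wherever the guard holds at the prefix letters.
[cite: Balaban1985Variational, Prop. 8 p.304, (7) p.278; Balaban1984PropagatorsII, (2.3) p.224; Balaban1988Convergent, (2.18) p.257] -/
theorem prop8RegSepTopStepGB_binders_inhabited_flat_lam
    (Sup : (ν : Stage7Numerics) → (K : ℕ) → (ℕ → Set (Site (F.P K) 0)) → Set (Site (F.P K) 0)) {Adm : StepGuard F}
    {B₃ a₀ a₁ : ℝ} (hB₃ : 0 < B₃) (ha₀ : 0 < a₀) (ha₁ : 0 < a₁) (ν : Stage7Numerics) (hM₁ : 0 < ν.M₁) {M : ℕ} (hM : 1 ≤ M) (g : ℕ → ℝ) (K k : ℕ) (hk : 1 ≤ k)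
    (hAdm : ∀ s : SeqOfRecord F ν M g K k, Adm ν M g K k s) :
    ∃ (s : SeqOfRecord F ν M g K k) (ε₀ : ℝ) (δ : ℕ → ℝ) (W : MSField (F.P K) (SU N)) (U : GaugeField (F.P K) 0 (SU N)),
      Sect2.SeqSeparated ν.M₁ s ∧ 0 < ν.M₁ ∧ Adm ν M g K k s ∧ 1 ≤ k ∧
      (∀ n, n ≤ k → 0 < δ n ∧ δ n ≤ a₁ ∧ B₃ * δ n ≤ ε₀) ∧ (∀ n, n < k → δ n ≤ 2 * δ (n + 1)) ∧ (∀ n, n < k → δ (n + 1) ≤ 2 * δ n) ∧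
      ε₀ ≤ a₀ ∧ dataSmall7LamTopOf F N K s.Ω (Sup ν K s.Ω) k δ W ∧
      (∀ n, n ≤ k → PlaqSmallOn (Sect2.omegaPlaqsTop s.Ω (Sup ν K s.Ω) n) (ε₀ * (F.P K).eta n ^ 2) U) ∧
      Sect2.CoDivClassOnTop s.Ω (Sup ν K s.Ω) k ε₀ U ∧ AgreeOnB (lamDatum F K k s.Ω) (avgFamily (avOfRecord F N K) U) W ∧
      IsCritOnFibreB F N K (lamDatum F K k s.Ω) W U ∧
      ((∀ n, n ≤ k → PlaqSmallOn (Sect2.omegaPlaqsTop s.Ω (Sup ν K s.Ω) n) (B₃ * δ n * (F.P K).eta n ^ 2) U) ∧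
        ∀ n, n ≤ k → Sect2.CoDivSmallOn (Sect2.omegaBondsTop s.Ω (Sup ν K s.Ω) n) (B₃ * δ n * (F.P K).eta n ^ 3) U) :=
  prop8RegSepTopStepGB_binders_inhabited_flat F N Sup (lamDatum F) (Dat := dataSmall7LamTopOf F N) (dataSmall7LamTopOf_one F N) hB₃ ha₀ ha₁ ν hM₁ hM g K k hk hAdm

/-- ★★ **A6 AT PRINT's DATUM FOR SECT. F's ONE-STEP IMPROVEMENT** `HalvingStepTopGB … (lamDatum F) (dataSmall7LamTopOf F N)`. [cite: Balaban1985Variational, Sect. F p.304, (7) p.278; Balaban1984PropagatorsII, (2.3) p.224] -/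
theorem halvingStepTopGB_binders_inhabited_flat_lam
    (Sup : (ν : Stage7Numerics) → (K : ℕ) → (ℕ → Set (Site (F.P K) 0)) → Set (Site (F.P K) 0)) {Adm : StepGuard F}
    {B₃ a₀ a₁ : ℝ} (hB₃ : 0 < B₃) (ha₀ : 0 < a₀) (ha₁ : 0 < a₁) (ν : Stage7Numerics) (hM₁ : 0 < ν.M₁) {M : ℕ} (hM : 1 ≤ M) (g : ℕ → ℝ) (K k : ℕ) (hk : 1 ≤ k)
    (hAdm : ∀ s : SeqOfRecord F ν M g K k, Adm ν M g K k s) :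
    ∃ (s : SeqOfRecord F ν M g K k) (ε δ : ℕ → ℝ) (W : MSField (F.P K) (SU N)) (U : GaugeField (F.P K) 0 (SU N)),
      Sect2.SeqSeparated ν.M₁ s ∧ 0 < ν.M₁ ∧ Adm ν M g K k s ∧ 1 ≤ k ∧
      (∀ n, n ≤ k → 0 < δ n ∧ δ n ≤ a₁) ∧ (∀ n, n < k → δ n ≤ 2 * δ (n + 1)) ∧ (∀ n, n < k → δ (n + 1) ≤ 2 * δ n) ∧
      (∀ n, n ≤ k → B₃ * δ n ≤ ε n ∧ ε n ≤ a₀) ∧ (∀ n, n < k → ε n ≤ 2 * ε (n + 1)) ∧ (∀ n, n < k → ε (n + 1) ≤ 2 * ε n) ∧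
      dataSmall7LamTopOf F N K s.Ω (Sup ν K s.Ω) k δ W ∧
      (∀ n, n ≤ k → PlaqSmallOn (Sect2.omegaPlaqsTop s.Ω (Sup ν K s.Ω) n) (ε n * (F.P K).eta n ^ 2) U) ∧
      (∀ n, n ≤ k → Sect2.CoDivSmallOn (Sect2.omegaBondsTop s.Ω (Sup ν K s.Ω) n) (ε n * (F.P K).eta n ^ 3) U) ∧
      AgreeOnB (lamDatum F K k s.Ω) (avgFamily (avOfRecord F N K) U) W ∧ IsCritOnFibreB F N K (lamDatum F K k s.Ω) W U ∧
      ((∀ n, n ≤ k → PlaqSmallOn (Sect2.omegaPlaqsTop s.Ω (Sup ν K s.Ω) n) (max (B₃ * δ n) (ε n / 2) * (F.P K).eta n ^ 2) U) ∧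
        ∀ n, n ≤ k → Sect2.CoDivSmallOn (Sect2.omegaBondsTop s.Ω (Sup ν K s.Ω) n) (max (B₃ * δ n) (ε n / 2) * (F.P K).eta n ^ 3) U) :=
  halvingStepTopGB_binders_inhabited_flat F N Sup (lamDatum F) (Dat := dataSmall7LamTopOf F N) (dataSmall7LamTopOf_one F N) hB₃ ha₀ ha₁ ν hM₁ hM g K k hk hAdm

/-- ★★ **A6 AT PRINT's DATUM FOR THE CORE FORM** `HalvingStepTopCoreGB … (lamDatum F) (dataSmall7LamTopOf F N) (lamPlaqs0Of F)` (the exclusion range of dag-n07-e's `K0HalvingStepOfCoreB`).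
[cite: Balaban1985Variational, Sect. F p.304, (7) p.278; Balaban1985RegularSpaces, (1.2) p.76; Balaban1984PropagatorsII, (2.3) p.224] -/
theorem halvingStepTopCoreGB_binders_inhabited_flat_lam
    (Sup : (ν : Stage7Numerics) → (K : ℕ) → (ℕ → Set (Site (F.P K) 0)) → Set (Site (F.P K) 0)) {Adm : StepGuard F}
    {B₃ a₀ a₁ : ℝ} (hB₃ : 0 < B₃) (ha₀ : 0 < a₀) (ha₁ : 0 < a₁) (ν : Stage7Numerics) (hM₁ : 0 < ν.M₁) {M : ℕ} (hM : 1 ≤ M) (g : ℕ → ℝ) (K k : ℕ) (hk : 1 ≤ k)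
    (hAdm : ∀ s : SeqOfRecord F ν M g K k, Adm ν M g K k s) :
    ∃ (s : SeqOfRecord F ν M g K k) (ε δ : ℕ → ℝ) (W : MSField (F.P K) (SU N)) (U : GaugeField (F.P K) 0 (SU N)),
      Sect2.SeqSeparated ν.M₁ s ∧ 0 < ν.M₁ ∧ Adm ν M g K k s ∧ 1 ≤ k ∧
      (∀ n, n ≤ k → 0 < δ n ∧ δ n ≤ a₁) ∧ (∀ n, n < k → δ n ≤ 2 * δ (n + 1)) ∧ (∀ n, n < k → δ (n + 1) ≤ 2 * δ n) ∧
      (∀ n, n ≤ k → B₃ * δ n ≤ ε n ∧ ε n ≤ a₀) ∧ (∀ n, n < k → ε n ≤ 2 * ε (n + 1)) ∧ (∀ n, n < k → ε (n + 1) ≤ 2 * ε n) ∧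
      dataSmall7LamTopOf F N K s.Ω (Sup ν K s.Ω) k δ W ∧
      (∀ n, n ≤ k → PlaqSmallOn (Sect2.omegaPlaqsTop s.Ω (Sup ν K s.Ω) n) (ε n * (F.P K).eta n ^ 2) U) ∧
      (∀ n, n ≤ k → Sect2.CoDivSmallOn (Sect2.omegaBondsTop s.Ω (Sup ν K s.Ω) n) (ε n * (F.P K).eta n ^ 3) U) ∧
      AgreeOnB (lamDatum F K k s.Ω) (avgFamily (avOfRecord F N K) U) W ∧ IsCritOnFibreB F N K (lamDatum F K k s.Ω) W U ∧
      ((∀ n, n ≤ k → ∀ p ∈ Sect2.omegaPlaqsTop s.Ω (Sup ν K s.Ω) n, p ∉ lamPlaqs0Of F K k s.Ω →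
          dist1 (GaugeField.plaqHol U p) < max (B₃ * δ n) (ε n / 2) * (F.P K).eta n ^ 2) ∧
        ∀ n, n ≤ k → ∀ b ∈ Sect2.omegaBondsTop s.Ω (Sup ν K s.Ω) n, b ∉ Sect2.bondsDeep (s.Ω 1)ᶜ →
          ‖Sect2.coDivSum U b.src b.dir‖ < max (B₃ * δ n) (ε n / 2) * (F.P K).eta n ^ 3) :=
  halvingStepTopCoreGB_binders_inhabited_flat F N Sup (lamDatum F) (Dat := dataSmall7LamTopOf F N) (lamPlaqs0Of F) (dataSmall7LamTopOf_one F N)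
    hB₃ ha₀ ha₁ ν hM₁ hM g K k hk hAdm

/-- ★ **A6 IN READING (b)** for [15] Prop. 8's top step `Prop8RegSepTopStepGB … (genSetDatum F) (dataSmall7PTopOf F N)` — F0c's `Iff.rfl`-instance of module 47's `Prop8RegSepTopStepG` — under any
guard met at the prefix letters (module 32's witness with the guard conjunct added). [cite: Balaban1985Variational, Prop. 8 p.304, (7) p.278; Balaban1988Convergent, (2.10) p.256, (2.18) p.257] -/
theorem prop8RegSepTopStepGB_binders_inhabited_flat_b
    (Sup : (ν : Stage7Numerics) → (K : ℕ) → (ℕ → Set (Site (F.P K) 0)) → Set (Site (F.P K) 0)) {Adm : StepGuard F}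
    {B₃ a₀ a₁ : ℝ} (hB₃ : 0 < B₃) (ha₀ : 0 < a₀) (ha₁ : 0 < a₁) (ν : Stage7Numerics) (hM₁ : 0 < ν.M₁) {M : ℕ} (hM : 1 ≤ M) (g : ℕ → ℝ) (K k : ℕ) (hk : 1 ≤ k)
    (hAdm : ∀ s : SeqOfRecord F ν M g K k, Adm ν M g K k s) :
    ∃ (s : SeqOfRecord F ν M g K k) (ε₀ : ℝ) (δ : ℕ → ℝ) (W : MSField (F.P K) (SU N)) (U : GaugeField (F.P K) 0 (SU N)),
      Sect2.SeqSeparated ν.M₁ s ∧ 0 < ν.M₁ ∧ Adm ν M g K k s ∧ 1 ≤ k ∧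
      (∀ n, n ≤ k → 0 < δ n ∧ δ n ≤ a₁ ∧ B₃ * δ n ≤ ε₀) ∧ (∀ n, n < k → δ n ≤ 2 * δ (n + 1)) ∧ (∀ n, n < k → δ (n + 1) ≤ 2 * δ n) ∧
      ε₀ ≤ a₀ ∧ dataSmall7PTopOf F N K s.Ω (Sup ν K s.Ω) k δ W ∧
      (∀ n, n ≤ k → PlaqSmallOn (Sect2.omegaPlaqsTop s.Ω (Sup ν K s.Ω) n) (ε₀ * (F.P K).eta n ^ 2) U) ∧
      Sect2.CoDivClassOnTop s.Ω (Sup ν K s.Ω) k ε₀ U ∧ AgreeOnB (genSetDatum F K k s.Ω) (avgFamily (avOfRecord F N K) U) W ∧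
      IsCritOnFibreB F N K (genSetDatum F K k s.Ω) W U ∧
      ((∀ n, n ≤ k → PlaqSmallOn (Sect2.omegaPlaqsTop s.Ω (Sup ν K s.Ω) n) (B₃ * δ n * (F.P K).eta n ^ 2) U) ∧
        ∀ n, n ≤ k → Sect2.CoDivSmallOn (Sect2.omegaBondsTop s.Ω (Sup ν K s.Ω) n) (B₃ * δ n * (F.P K).eta n ^ 3) U) :=
  prop8RegSepTopStepGB_binders_inhabited_flat F N Sup (genSetDatum F) (Dat := dataSmall7PTopOf F N) (dataSmall7PTopOf_one F N) hB₃ ha₀ ha₁ ν hM₁ hM g K k hk hAdm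

/-- ★ **A6 IN READING (b) FOR THE CORE FORM** `HalvingStepTopCoreGB … (genSetDatum F) (dataSmall7PTopOf F N) (printedPlaqs0Of F)` — F0c's `Iff.rfl`-instance of module 47's core token;
k0-s1-w3's `halvingStepTopCoreG_binders_inhabited_flat` in the `(bd, Dat, Ex0)` spelling. [cite: Balaban1985Variational, Sect. F p.304, (7) p.278; Balaban1985RegularSpaces, (1.2) p.76; Balaban1988Convergent, (2.10) p.256] -/
theorem halvingStepTopCoreGB_binders_inhabited_flat_b
    (Sup : (ν : Stage7Numerics) → (K : ℕ) → (ℕ → Set (Site (F.P K) 0)) → Set (Site (F.P K) 0)) {Adm : StepGuard F}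
    {B₃ a₀ a₁ : ℝ} (hB₃ : 0 < B₃) (ha₀ : 0 < a₀) (ha₁ : 0 < a₁) (ν : Stage7Numerics) (hM₁ : 0 < ν.M₁) {M : ℕ} (hM : 1 ≤ M) (g : ℕ → ℝ) (K k : ℕ) (hk : 1 ≤ k)
    (hAdm : ∀ s : SeqOfRecord F ν M g K k, Adm ν M g K k s) :
    ∃ (s : SeqOfRecord F ν M g K k) (ε δ : ℕ → ℝ) (W : MSField (F.P K) (SU N)) (U : GaugeField (F.P K) 0 (SU N)),
      Sect2.SeqSeparated ν.M₁ s ∧ 0 < ν.M₁ ∧ Adm ν M g K k s ∧ 1 ≤ k ∧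
      (∀ n, n ≤ k → 0 < δ n ∧ δ n ≤ a₁) ∧ (∀ n, n < k → δ n ≤ 2 * δ (n + 1)) ∧ (∀ n, n < k → δ (n + 1) ≤ 2 * δ n) ∧
      (∀ n, n ≤ k → B₃ * δ n ≤ ε n ∧ ε n ≤ a₀) ∧ (∀ n, n < k → ε n ≤ 2 * ε (n + 1)) ∧ (∀ n, n < k → ε (n + 1) ≤ 2 * ε n) ∧
      dataSmall7PTopOf F N K s.Ω (Sup ν K s.Ω) k δ W ∧
      (∀ n, n ≤ k → PlaqSmallOn (Sect2.omegaPlaqsTop s.Ω (Sup ν K s.Ω) n) (ε n * (F.P K).eta n ^ 2) U) ∧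
      (∀ n, n ≤ k → Sect2.CoDivSmallOn (Sect2.omegaBondsTop s.Ω (Sup ν K s.Ω) n) (ε n * (F.P K).eta n ^ 3) U) ∧
      AgreeOnB (genSetDatum F K k s.Ω) (avgFamily (avOfRecord F N K) U) W ∧ IsCritOnFibreB F N K (genSetDatum F K k s.Ω) W U ∧
      ((∀ n, n ≤ k → ∀ p ∈ Sect2.omegaPlaqsTop s.Ω (Sup ν K s.Ω) n, p ∉ printedPlaqs0Of F K k s.Ω →
          dist1 (GaugeField.plaqHol U p) < max (B₃ * δ n) (ε n / 2) * (F.P K).eta n ^ 2) ∧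
        ∀ n, n ≤ k → ∀ b ∈ Sect2.omegaBondsTop s.Ω (Sup ν K s.Ω) n, b ∉ Sect2.bondsDeep (s.Ω 1)ᶜ →
          ‖Sect2.coDivSum U b.src b.dir‖ < max (B₃ * δ n) (ε n / 2) * (F.P K).eta n ^ 3) :=
  halvingStepTopCoreGB_binders_inhabited_flat F N Sup (genSetDatum F) (Dat := dataSmall7PTopOf F N) (printedPlaqs0Of F) (dataSmall7PTopOf_one F N)
    hB₃ ha₀ ha₁ ν hM₁ hM g K k hk hAdm

end Instances

end Summit.QuantumFields.YangMills.BalabanUVNodes.K0FlatWitnessB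

end
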